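import Mathlib.Analysis.SpecialFunctions.ArithmeticGeometricMean
import Mathlib.Analysis.Real.Pi.Bounds
import Literature.Probability.RandomPlanarGeometry.EllipticKAGM
import HarnessLib

/-!
# Monotonicity of the AGM and certified enclosures of `K` by directed rounding

Topic `Literature/Analysis/SpecialFunctions`. Gauss's formula `K(m) = π / (2·M(1, √(1-m)))`
(`Literature.Probability.RandomPlanarGeometry.ellipticK_compl_eq_pi_div_agm`, Borwein–Borwein Thm 1.1,
over Mathlib's `NNReal.agm`) turns the evaluation of the complete elliptic integral into the
quadratically convergent AGM iteration `aₙ₊₁ = (aₙ+bₙ)/2`, `bₙ₊₁ = √(aₙbₙ)`, `bₙ ≤ M ≤ aₙ`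
(Brent–Zimmermann, *Modern Computer Arithmetic*, §4.8; Borwein–Borwein §1.1). To make the resulting
bounds *certifiable in exact rational arithmetic* one needs that the iteration may be run with
**directed rounding** — square roots rounded down (resp. up) to rationals — without losing the
enclosure. The underlying fact is the monotonicity of the AGM in both arguments, which Mathlib's
`ArithmeticGeometricMean` file does not record. This file proves

* `agmSequences_mono`, `agm_mono` — `x ≤ x'`, `y ≤ y'` ⟹ `M(x,y) ≤ M(x',y')`;
* `agm_le_agm_of_roundDown` / `agm_le_agm_of_roundUp` — one AGM step with the means rounded
  down (`a' ≤ (a+b)/2`, `b'² ≤ ab`) does not increase `M`, rounded up does not decrease it;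
* `agm_chainDown_le`, `min_le_agm_of_chainDown`, `le_agm_chainUp`, `agm_le_max_of_chainUp` — the
  `N`-step versions: a rounded-down chain ends below `M`, a rounded-up chain ends above it;
* `ellipticK_eq_pi_div_agm_sqrt_one_sub` — `K(m) = π/(2 M(1, √(1-m)))` for all `m < 1`;
* `le_ellipticK_of_agmChainUp`, `ellipticK_le_of_agmChainDown` — **two-sided rational enclosures
  of `K(m)`**: every hypothesis is a polynomial inequality between the (rational) chain entries,
  `m`, and a rational bound for `π` (Mathlib `Real.pi_gt_d20` / `Real.pi_lt_d20`), so a table of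
  certified values of `K` is checked row by row by `norm_num` / `decide`;
* `ellipticK_half_mem_Icc` — worked instance: `1.854074 ≤ K(1/2) ≤ 1.854075`
  (Abramowitz–Stegun Table 17.1: `K(0.5) = 1.85407 46773`), four rounded AGM steps at `10⁻⁹`.

## References
* [BorweinBorwein1987] J. M. Borwein, P. B. Borwein, *Pi and the AGM*, Wiley (1987), §1.1, Thm 1.1.
* [BrentZimmermann2010] R. P. Brent, P. Zimmermann, *Modern Computer Arithmetic*, CUP (2010), §4.8
  (AGM-based evaluation; error analysis of the truncated/rounded iteration).
* [AbramowitzStegun1964] M. Abramowitz, I. Stegun, *Handbook of Mathematical Functions* (1964),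
  17.6 (AGM process for `K`), Table 17.1.
-/

noncomputable section

open _root_.Set NNReal
open Literature.Probability.RandomPlanarGeometry

namespace Literature.Analysis.SpecialFunctions

/-! ### Monotonicity of the AGM in its arguments -/

/-- Both AGM sequences are monotone in the initial data: `x ≤ x'`, `y ≤ y'` give
`bₙ(x,y) ≤ bₙ(x',y')` and `aₙ(x,y) ≤ aₙ(x',y')` for all `n` (the maps `(x,y) ↦ √(xy)` and
`(x,y) ↦ (x+y)/2` are monotone). [cite: BorweinBorwein1987, §1.1] -/
theorem agmSequences_mono {x x' y y' : ℝ≥0} (hx : x ≤ x') (hy : y ≤ y') (n : ℕ) :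
    (agmSequences x y n).1 ≤ (agmSequences x' y' n).1 ∧
      (agmSequences x y n).2 ≤ (agmSequences x' y' n).2 := by
  induction n generalizing x x' y y' with
  | zero =>
    simp only [agmSequences_zero]
    exact ⟨NNReal.sqrt_le_sqrt.2 (mul_le_mul' hx hy), by gcongr⟩
  | succ n ih =>
    rw [agmSequences_succ, agmSequences_succ]
    exact ih (NNReal.sqrt_le_sqrt.2 (mul_le_mul' hx hy)) (by gcongr)

/-- **The arithmetic–geometric mean is monotone in each argument**:
`x ≤ x'`, `y ≤ y'` ⟹ `M(x,y) ≤ M(x',y')`. [cite: BorweinBorwein1987, §1.1] -/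
theorem agm_mono {x x' y y' : ℝ≥0} (hx : x ≤ x') (hy : y ≤ y') : agm x y ≤ agm x' y' := by
  rw [agm_eq_ciInf (x := x') (y := y')]
  exact le_ciInf fun n => (agm_le_agmSequences_snd n).trans (agmSequences_mono hx hy n).2

/-! ### One AGM step with directed rounding -/

/-- **Rounding down.** If `a' ≤ (a+b)/2` and `b'² ≤ ab` (the two means rounded downwards) then
`M(a',b') ≤ M(a,b)` (`M(a,b) = M((a+b)/2, √(ab))` and monotonicity).
[cite: BrentZimmermann2010, §4.8] -/
theorem agm_le_agm_of_roundDown {a b a' b' : ℝ≥0} (ha' : a' ≤ (a + b) / 2) (hb' : b' ^ 2 ≤ a * b) :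
    agm a' b' ≤ agm a b :=
  calc agm a' b' ≤ agm ((a + b) / 2) (sqrt (a * b)) := agm_mono ha' (NNReal.le_sqrt_iff_sq_le.2 hb')
    _ = agm (sqrt (a * b)) ((a + b) / 2) := agm_comm
    _ = agm a b := agm_eq_agm_gm_am.symm

/-- **Rounding up.** If `(a+b)/2 ≤ a'` and `ab ≤ b'²` (the two means rounded upwards) then
`M(a,b) ≤ M(a',b')`. [cite: BrentZimmermann2010, §4.8] -/
theorem agm_le_agm_of_roundUp {a b a' b' : ℝ≥0} (ha' : (a + b) / 2 ≤ a') (hb' : a * b ≤ b' ^ 2) :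
    agm a b ≤ agm a' b' :=
  calc agm a b = agm (sqrt (a * b)) ((a + b) / 2) := agm_eq_agm_gm_am
    _ = agm ((a + b) / 2) (sqrt (a * b)) := agm_comm
    _ ≤ agm a' b' := agm_mono ha' (NNReal.sqrt_le_iff_le_sq.2 hb')

/-! ### Chains of rounded AGM steps -/

/-- An `N`-step chain of AGM steps rounded DOWN (`Aᵢ₊₁ ≤ (Aᵢ+Bᵢ)/2`, `Bᵢ₊₁² ≤ AᵢBᵢ`) does not
increase the AGM: `M(A_N, B_N) ≤ M(A₀, B₀)`. [cite: BrentZimmermann2010, §4.8] -/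
theorem agm_chainDown_le {N : ℕ} {A B : ℕ → ℝ≥0}
    (hA : ∀ i < N, A (i + 1) ≤ (A i + B i) / 2) (hB : ∀ i < N, B (i + 1) ^ 2 ≤ A i * B i) :
    agm (A N) (B N) ≤ agm (A 0) (B 0) := by
  induction N with
  | zero => exact le_rfl
  | succ n ih =>
    calc agm (A (n + 1)) (B (n + 1)) ≤ agm (A n) (B n) :=
          agm_le_agm_of_roundDown (hA n (Nat.lt_succ_self n)) (hB n (Nat.lt_succ_self n))
      _ ≤ agm (A 0) (B 0) := ih (fun i hi => hA i (hi.trans (Nat.lt_succ_self n)))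
          (fun i hi => hB i (hi.trans (Nat.lt_succ_self n)))

/-- … hence the last pair of a rounded-down chain bounds the AGM from below:
`min(A_N, B_N) ≤ M(A₀, B₀)`. [cite: BrentZimmermann2010, §4.8] -/
theorem min_le_agm_of_chainDown {N : ℕ} {A B : ℕ → ℝ≥0}
    (hA : ∀ i < N, A (i + 1) ≤ (A i + B i) / 2) (hB : ∀ i < N, B (i + 1) ^ 2 ≤ A i * B i) :
    min (A N) (B N) ≤ agm (A 0) (B 0) :=
  min_le_agm.trans (agm_chainDown_le hA hB)

/-- An `N`-step chain of AGM steps rounded UP (`(Aᵢ+Bᵢ)/2 ≤ Aᵢ₊₁`, `AᵢBᵢ ≤ Bᵢ₊₁²`) does not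
decrease the AGM: `M(A₀, B₀) ≤ M(A_N, B_N)`. [cite: BrentZimmermann2010, §4.8] -/
theorem le_agm_chainUp {N : ℕ} {A B : ℕ → ℝ≥0}
    (hA : ∀ i < N, (A i + B i) / 2 ≤ A (i + 1)) (hB : ∀ i < N, A i * B i ≤ B (i + 1) ^ 2) :
    agm (A 0) (B 0) ≤ agm (A N) (B N) := by
  induction N with
  | zero => exact le_rfl
  | succ n ih =>
    calc agm (A 0) (B 0) ≤ agm (A n) (B n) := ih (fun i hi => hA i (hi.trans (Nat.lt_succ_self n)))
          (fun i hi => hB i (hi.trans (Nat.lt_succ_self n)))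
      _ ≤ agm (A (n + 1)) (B (n + 1)) :=
          agm_le_agm_of_roundUp (hA n (Nat.lt_succ_self n)) (hB n (Nat.lt_succ_self n))

/-- … hence the last pair of a rounded-up chain bounds the AGM from above:
`M(A₀, B₀) ≤ max(A_N, B_N)`. [cite: BrentZimmermann2010, §4.8] -/
theorem agm_le_max_of_chainUp {N : ℕ} {A B : ℕ → ℝ≥0}
    (hA : ∀ i < N, (A i + B i) / 2 ≤ A (i + 1)) (hB : ∀ i < N, A i * B i ≤ B (i + 1) ^ 2) :
    agm (A 0) (B 0) ≤ max (A N) (B N) :=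
  (le_agm_chainUp hA hB).trans agm_le_max

/-! ### `K(m) = π / (2 M(1, √(1-m)))` and rational enclosures of `K` -/

/-- Gauss's formula in the parameter: for every `m < 1`,
`K(m) = ellipticK m = π / (2·M(1, √(1-m)))` (the tree's `ellipticK_compl_eq_pi_div_agm` at the
complementary modulus `k′ = √(1-m) > 0`). [cite: BorweinBorwein1987, Thm 1.1] -/
theorem ellipticK_eq_pi_div_agm_sqrt_one_sub {m : ℝ} (hm : m < 1) :
    ellipticK m = Real.pi / (2 * agm 1 ⟨Real.sqrt (1 - m), Real.sqrt_nonneg _⟩) := by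
  have hk : (0 : ℝ≥0) < ⟨Real.sqrt (1 - m), Real.sqrt_nonneg _⟩ :=
    NNReal.coe_pos.1 (Real.sqrt_pos.2 (by linarith))
  have h := ellipticK_compl_eq_pi_div_agm hk
  have h' : ellipticK (1 - Real.sqrt (1 - m) ^ 2)
      = Real.pi / (2 * agm 1 ⟨Real.sqrt (1 - m), Real.sqrt_nonneg _⟩) := h
  rw [Real.sq_sqrt (by linarith : (0:ℝ) ≤ 1 - m), sub_sub_cancel] at h'
  exact h'

/-- The AGM `M(1, √(1-m))` is positive for `m < 1`. [cite: BorweinBorwein1987, Thm 1.1] -/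
theorem agm_one_sqrt_one_sub_pos {m : ℝ} (hm : m < 1) :
    (0 : ℝ) < agm 1 ⟨Real.sqrt (1 - m), Real.sqrt_nonneg _⟩ :=
  NNReal.coe_pos.2 (agm_pos one_pos (NNReal.coe_pos.1 (Real.sqrt_pos.2 (by linarith))))

/-- Transfer of a real chain with nonnegative entries to `ℝ≥0` (rounded UP steps). [folklore] -/
private theorem chainUp_toNNReal {N : ℕ} {A B : ℕ → ℝ} (hAnn : ∀ i ≤ N, 0 ≤ A i)
    (hBnn : ∀ i ≤ N, 0 ≤ B i) (hA : ∀ i < N, (A i + B i) / 2 ≤ A (i + 1))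
    (hB : ∀ i < N, A i * B i ≤ B (i + 1) ^ 2) :
    (∀ i < N, ((A i).toNNReal + (B i).toNNReal) / 2 ≤ (A (i + 1)).toNNReal) ∧
      (∀ i < N, (A i).toNNReal * (B i).toNNReal ≤ (B (i + 1)).toNNReal ^ 2) := by
  refine ⟨fun i hi => ?_, fun i hi => ?_⟩
  · rw [← NNReal.coe_le_coe]
    push_cast
    rw [Real.coe_toNNReal _ (hAnn i hi.le), Real.coe_toNNReal _ (hBnn i hi.le),
      Real.coe_toNNReal _ (hAnn (i + 1) hi)]
    exact hA i hi
  · rw [← NNReal.coe_le_coe]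
    push_cast
    rw [Real.coe_toNNReal _ (hAnn i hi.le), Real.coe_toNNReal _ (hBnn i hi.le),
      Real.coe_toNNReal _ (hBnn (i + 1) hi)]
    exact hB i hi

/-- Transfer of a real chain with nonnegative entries to `ℝ≥0` (rounded DOWN steps). [folklore] -/
private theorem chainDown_toNNReal {N : ℕ} {A B : ℕ → ℝ} (hAnn : ∀ i ≤ N, 0 ≤ A i)
    (hBnn : ∀ i ≤ N, 0 ≤ B i) (hA : ∀ i < N, A (i + 1) ≤ (A i + B i) / 2)
    (hB : ∀ i < N, B (i + 1) ^ 2 ≤ A i * B i) :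
    (∀ i < N, (A (i + 1)).toNNReal ≤ ((A i).toNNReal + (B i).toNNReal) / 2) ∧
      (∀ i < N, (B (i + 1)).toNNReal ^ 2 ≤ (A i).toNNReal * (B i).toNNReal) := by
  refine ⟨fun i hi => ?_, fun i hi => ?_⟩
  · rw [← NNReal.coe_le_coe]
    push_cast
    rw [Real.coe_toNNReal _ (hAnn i hi.le), Real.coe_toNNReal _ (hBnn i hi.le),
      Real.coe_toNNReal _ (hAnn (i + 1) hi)]
    exact hA i hi
  · rw [← NNReal.coe_le_coe]
    push_cast
    rw [Real.coe_toNNReal _ (hAnn i hi.le), Real.coe_toNNReal _ (hBnn i hi.le),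
      Real.coe_toNNReal _ (hBnn (i + 1) hi)]
    exact hB i hi

/-- **Certified lower bound for `K(m)` from a rounded-up AGM chain.** Let `m < 1` and let
`A, B` be (rational) sequences with nonnegative entries such that `1 ≤ A₀`, `1 - m ≤ B₀²`
(so `√(1-m) ≤ B₀`), and for `i < N`: `(Aᵢ+Bᵢ)/2 ≤ Aᵢ₊₁`, `AᵢBᵢ ≤ Bᵢ₊₁²` (means rounded up).
Then `M(1, √(1-m)) ≤ max(A_N, B_N)`, hence for every `p ≤ π`:
`p / (2·max(A_N, B_N)) ≤ K(m)`. All hypotheses are polynomial inequalities in the data.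
[cite: BrentZimmermann2010, §4.8] -/
theorem le_ellipticK_of_agmChainUp {m : ℝ} (hm : m < 1) {N : ℕ} {A B : ℕ → ℝ}
    (hAnn : ∀ i ≤ N, 0 ≤ A i) (hBnn : ∀ i ≤ N, 0 ≤ B i) (hA0 : 1 ≤ A 0) (hB0 : 1 - m ≤ B 0 ^ 2)
    (hA : ∀ i < N, (A i + B i) / 2 ≤ A (i + 1)) (hB : ∀ i < N, A i * B i ≤ B (i + 1) ^ 2)
    {p : ℝ} (hp : p ≤ Real.pi) :
    p / (2 * max (A N) (B N)) ≤ ellipticK m := by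
  obtain ⟨k', hk'⟩ : ∃ k' : ℝ≥0, k' = ⟨Real.sqrt (1 - m), Real.sqrt_nonneg _⟩ := ⟨_, rfl⟩
  have hM : (0 : ℝ) < agm 1 k' := hk' ▸ agm_one_sqrt_one_sub_pos hm
  obtain ⟨hA', hB'⟩ := chainUp_toNNReal hAnn hBnn hA hB
  -- `M(1, k') ≤ M(A₀, B₀) ≤ max (A_N, B_N)`
  have h1 : (1 : ℝ≥0) ≤ (A 0).toNNReal := by
    rw [← NNReal.coe_le_coe, NNReal.coe_one, Real.coe_toNNReal _ (hAnn 0 (Nat.zero_le N))]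
    exact hA0
  have h2 : k' ≤ (B 0).toNNReal := by
    rw [← NNReal.coe_le_coe, Real.coe_toNNReal _ (hBnn 0 (Nat.zero_le N)), hk']
    change Real.sqrt (1 - m) ≤ B 0
    exact Real.sqrt_le_iff.2 ⟨hBnn 0 (Nat.zero_le N), hB0⟩
  have hle : agm 1 k' ≤ max ((A N).toNNReal) ((B N).toNNReal) :=
    (agm_mono h1 h2).trans
      (agm_le_max_of_chainUp (A := fun i => (A i).toNNReal) (B := fun i => (B i).toNNReal) hA' hB')
  have hleR : (agm 1 k' : ℝ) ≤ max (A N) (B N) := by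
    have := NNReal.coe_le_coe.2 hle
    rw [NNReal.coe_max, Real.coe_toNNReal _ (hAnn N le_rfl), Real.coe_toNNReal _ (hBnn N le_rfl)]
      at this
    exact this
  rw [ellipticK_eq_pi_div_agm_sqrt_one_sub hm, ← hk']
  have hU : (0 : ℝ) < 2 * max (A N) (B N) := by linarith
  have h2M : (0 : ℝ) < 2 * (agm 1 k' : ℝ) := by linarith
  calc p / (2 * max (A N) (B N)) ≤ Real.pi / (2 * max (A N) (B N)) :=
        div_le_div_of_nonneg_right hp hU.le
    _ ≤ Real.pi / (2 * (agm 1 k' : ℝ)) :=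
        div_le_div_of_nonneg_left Real.pi_pos.le h2M (by linarith)

/-- **Certified upper bound for `K(m)` from a rounded-down AGM chain.** Let `m < 1` and let
`A, B` be (rational) sequences with nonnegative entries such that `A₀ ≤ 1`, `B₀² ≤ 1 - m`
(so `B₀ ≤ √(1-m)`), for `i < N`: `Aᵢ₊₁ ≤ (Aᵢ+Bᵢ)/2`, `Bᵢ₊₁² ≤ AᵢBᵢ` (means rounded down), and
`0 < min(A_N, B_N)`. Then `min(A_N, B_N) ≤ M(1, √(1-m))`, hence for every `q ≥ π`:
`K(m) ≤ q / (2·min(A_N, B_N))`. [cite: BrentZimmermann2010, §4.8] -/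
theorem ellipticK_le_of_agmChainDown {m : ℝ} (hm : m < 1) {N : ℕ} {A B : ℕ → ℝ}
    (hAnn : ∀ i ≤ N, 0 ≤ A i) (hBnn : ∀ i ≤ N, 0 ≤ B i) (hA0 : A 0 ≤ 1) (hB0 : B 0 ^ 2 ≤ 1 - m)
    (hA : ∀ i < N, A (i + 1) ≤ (A i + B i) / 2) (hB : ∀ i < N, B (i + 1) ^ 2 ≤ A i * B i)
    (hL : 0 < min (A N) (B N)) {q : ℝ} (hq : Real.pi ≤ q) :
    ellipticK m ≤ q / (2 * min (A N) (B N)) := by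
  obtain ⟨k', hk'⟩ : ∃ k' : ℝ≥0, k' = ⟨Real.sqrt (1 - m), Real.sqrt_nonneg _⟩ := ⟨_, rfl⟩
  have hM : (0 : ℝ) < agm 1 k' := hk' ▸ agm_one_sqrt_one_sub_pos hm
  obtain ⟨hA', hB'⟩ := chainDown_toNNReal hAnn hBnn hA hB
  have h1 : (A 0).toNNReal ≤ 1 := by
    rw [← NNReal.coe_le_coe, NNReal.coe_one, Real.coe_toNNReal _ (hAnn 0 (Nat.zero_le N))]
    exact hA0
  have h2 : (B 0).toNNReal ≤ k' := by
    rw [← NNReal.coe_le_coe, Real.coe_toNNReal _ (hBnn 0 (Nat.zero_le N)), hk']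
    change B 0 ≤ Real.sqrt (1 - m)
    exact Real.le_sqrt_of_sq_le hB0
  have hle : min ((A N).toNNReal) ((B N).toNNReal) ≤ agm 1 k' :=
    (min_le_agm_of_chainDown (A := fun i => (A i).toNNReal) (B := fun i => (B i).toNNReal)
      hA' hB').trans (agm_mono h1 h2)
  have hleR : min (A N) (B N) ≤ (agm 1 k' : ℝ) := by
    have := NNReal.coe_le_coe.2 hle
    rw [NNReal.coe_min, Real.coe_toNNReal _ (hAnn N le_rfl), Real.coe_toNNReal _ (hBnn N le_rfl)]
      at this
    exact this
  rw [ellipticK_eq_pi_div_agm_sqrt_one_sub hm, ← hk']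
  have hLpos : (0 : ℝ) < 2 * min (A N) (B N) := by linarith
  calc Real.pi / (2 * (agm 1 k' : ℝ)) ≤ Real.pi / (2 * min (A N) (B N)) :=
        div_le_div_of_nonneg_left Real.pi_pos.le hLpos (by linarith)
    _ ≤ q / (2 * min (A N) (B N)) := div_le_div_of_nonneg_right hq hLpos.le

/-- **The elementary AGM bound `K(m) ≤ π / (2√(1-m))` for `0 ≤ m < 1`** (`M(1,k′) ≥ min(1,k′) = k′`,
`k′ = √(1-m) ≤ 1`; sharp as `m → 0`, where both sides are `π/2`; false for `m < 0`). It is the source of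
the band-edge bound `ρ ≤ 1/(π√x)` for densities of states expressed through `K`.
[cite: BorweinBorwein1987, Thm 1.1] -/
theorem ellipticK_le_pi_div_two_mul_sqrt {m : ℝ} (hm0 : 0 ≤ m) (hm : m < 1) :
    ellipticK m ≤ Real.pi / (2 * Real.sqrt (1 - m)) := by
  have hk0 : 0 < Real.sqrt (1 - m) := Real.sqrt_pos.2 (by linarith)
  have hk1 : Real.sqrt (1 - m) ≤ 1 := Real.sqrt_le_one.mpr (by linarith)
  rw [ellipticK_eq_pi_div_agm_sqrt_one_sub hm]
  have hmin : (⟨Real.sqrt (1 - m), Real.sqrt_nonneg _⟩ : ℝ≥0) ≤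
      agm 1 ⟨Real.sqrt (1 - m), Real.sqrt_nonneg _⟩ := by
    refine le_trans (le_min ?_ le_rfl) min_le_agm
    exact NNReal.coe_le_coe.1 (by rw [NNReal.coe_one]; exact hk1)
  have hminR : Real.sqrt (1 - m) ≤ (agm 1 ⟨Real.sqrt (1 - m), Real.sqrt_nonneg _⟩ : ℝ) :=
    NNReal.coe_le_coe.2 hmin
  exact div_le_div_of_nonneg_left Real.pi_pos.le (by positivity) (by linarith)

/-! ### Worked instance: `K(1/2)` -/

/-- **`1.854074 ≤ K(1/2) ≤ 1.854075`** (Abramowitz–Stegun Table 17.1: `K(m = 0.5) = 1.85407 46773 01372`),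
certified by two four-step AGM chains with square roots rounded to `10⁻⁹` and Mathlib's
`3.141592 < π < 3.141593`; every side condition is closed by `norm_num`.
[cite: AbramowitzStegun1964, Table 17.1] -/
theorem ellipticK_half_mem_Icc : ellipticK (1 / 2) ∈ Icc (1.854074 : ℝ) 1.854075 := by
  have hm : (1 / 2 : ℝ) < 1 := by norm_num
  constructor
  · -- rounded-up chain
    have h := le_ellipticK_of_agmChainUp hm (N := 4)
      (A := fun i => if i = 0 then 1 else if i = 1 then 853553391/1000000000 else if i = 2 then
        1694449807/2000000000 else if i = 3 then 3388852343/4000000000 else 6777704687/8000000000)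
      (B := fun i => if i = 0 then 353553391/500000000 else if i = 1 then 26278013/31250000 else
        if i = 2 then 211800317/250000000 else 423606543/500000000)
      (by intro i hi; interval_cases i <;> norm_num)
      (by intro i hi; interval_cases i <;> norm_num)
      (by norm_num) (by norm_num)
      (by intro i hi; interval_cases i <;> norm_num)
      (by intro i hi; interval_cases i <;> norm_num)
      (p := 3.141592) Real.pi_gt_d6.le
    refine le_trans ?_ h
    norm_num
  · -- rounded-down chain
    have h := ellipticK_le_of_agmChainDown hm (N := 4)
      (A := fun i => if i = 0 then 1 else if i = 1 then 1707106781/2000000000 else if i = 2 then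
        3388899611/4000000000 else if i = 3 then 271108187/320000000 else 13555409347/16000000000)
      (B := fun i => if i = 0 then 707106781/1000000000 else if i = 1 then 168179283/200000000 else
        if i = 2 then 423600633/500000000 else 211803271/250000000)
      (by intro i hi; interval_cases i <;> norm_num)
      (by intro i hi; interval_cases i <;> norm_num)
      (by norm_num) (by norm_num)
      (by intro i hi; interval_cases i <;> norm_num)
      (by intro i hi; interval_cases i <;> norm_num)
      (by norm_num) (q := 3.141593) Real.pi_lt_d6.le
    refine le_trans h ?_
    norm_num

end Literature.Analysis.SpecialFunctions

end
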